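import Literature.NumberTheory.EllipticCurves.CanonicalPAdicHeightParallelogramProofs
import Literature.NumberTheory.EllipticCurves.FormalGroupShortModelParityProofs
import HarnessLib

/-!
# The canonical `p`-adic height of a point of `E₁(ℚ_p)` is `log_p` of the numerator of `x(P)`, up
# to `‖z(P)‖_p` (any integral equation), resp. `‖x(P)‖_p⁻¹` (equations with `a₁ = a₃ = 0`)

Sibling proof file of `CanonicalPAdicHeight.lean` (pure proofs: no definitions, no named facts).
The tree PINS the canonical cyclotomic `p`-adic height by the sigma formula of Mazur–Stein–Tate
2006 (1.1) in the Stein–Wuthrich 2013 (4.1) normalisation,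
`ĥ_p(P) = canonicalPAdicHeight p P = log_p(den x(P)) - 2 log_p σ_p(z(P))`, `z(P) = -x/y`
(`PAdicHeightData.IsCanonical D :↔ ⟨P,P⟩_D = ĥ_p(P)` on admissible `P`). This file proves the
first-order EVALUATION of that formula which every computation of `p`-adic heights uses
(Harvey 2008, §5: writing `P = (α/d², β/d³)`, `z(P) = -dα/β`,
`log_p(σ_p(P)/d(P)) = log_p(-(α/β)·(1 + Σ_{k≥1} c_{k+1} z(P)^k))` with `α/β` a unit and the bracket
a principal unit, and `‖log_p u - log_p u'‖ ≤ ‖u - u'‖` on units, Lemma 8), combined with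
`β² = α³·(1 + a₂d²/α + a₄d⁴/α² + a₆d⁶/α³)` (`+ a₁αβd + a₃βd³` on the left in general) from the
Weierstrass equation:

* `norm_canonicalPAdicHeight_sub_padicLog_num_le` — for ANY `ℤ`-integral equation `W/ℚ`, `p` odd,
  `P = (x, y) ∈ E(ℚ)` with `‖x‖_p > 1`: **`‖ĥ_p(P) - log_p(num x)‖_p ≤ ‖x/y‖_p`** (`= ‖z(P)‖_p`, and
  `‖z(P)‖_p² = ‖x‖_p⁻¹`, `norm_div_sq_eq_inv_norm_of_one_lt_norm`);
* `norm_canonicalPAdicHeight_sub_padicLog_num_le_inv` — if moreover `a₁ = a₃ = 0`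
  (`[W.IsCharNeTwoNF]`: `y² = x³ + a₂x² + a₄x + a₆`): **`‖ĥ_p(P) - log_p(num x)‖_p ≤ ‖x‖_p⁻¹`**,
  because then `σ_p` is an odd series (`σ_p = z + O(z³)`: Mazur–Tate oddness is plain oddness for
  such models, `IsFormallyOdd.coeff_eq_zero_of_even`) and `1 - a₁z - a₃z/x = 1 + O(z³)`;
* `PAdicHeightData.IsCanonical.norm_pairing_self_sub_padicLog_num_le[_inv]` — the same for
  `⟨P, P⟩_D`, `D` THE canonical datum, `P` admissible.

So on `E₁(ℚ_p)` the canonical height is, to first order, the Iwasawa logarithm of the numerator of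
`x(P)`: the non-archimedean analogue of `ĥ(P) = ½ h(x(P)) + O(1)`. Typical use: for explicit
points `Q` with `num x(Q)` known in closed form (e.g. `Q = 2P`, `x(2P) = (x² - a₄)²/(4y²)` a square
up to the denominator on `y² = x³ + a₂x² + a₄x`), `⟨Q, Q⟩` is known up to an explicit `p`-adic
error, which by the ultrametric inequality is enough to decide `Reg_p ≠ 0`
(`schneiderConjecture_of_padicRegulatorOf_ne_zero`, `PAdicRegulatorFiniteIndexProofs.lean`).

Proof (`norm_canonicalPAdicHeight_sub_le_aux`, the common engine with error parameter `ε`): with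
`X = x`, `t = z(P)`, `u = a₂/X + a₄/X² + a₆/X³` (`‖u‖ ≤ ‖X‖⁻¹ = ‖t‖²`, AEC VII.2.2 via the tree's
`v_zw_of_one_lt`), the equation reads `1 - a₁t - a₃t/X = X(1+u)t²`; `den x = num x / X`;
`σ_p(t) = t·S` with `‖S - 1‖ = ‖σ_p(t) - t‖/‖t‖` (`≤ ‖t‖`, resp. `≤ ‖t‖²` for odd `σ_p`:
`σ_p ∈ t + t²ℤ_p⟦t⟧` unconditionally, `norm_coeff_padicSigma_le`); multiplicativity of the Iwasawa
logarithm (the tree's theorem `padicLog_mul_holds`) gives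
`ĥ_p(P) - log_p(num x) = log_p(1+u) - log_p(1 - a₁t - a₃t/X) - 2 log_p S`, and each logarithm has
norm equal to the distance of its argument from `1` (`norm_padicLogSeries_eq`, `p` odd).

## References

* [Harvey2008] D. Harvey, *Efficient computation of `p`-adic heights*, LMS J. Comput. Math. 11
  (2008) 40–59 (arXiv:0708.3404), §2.2 (`P = (α/d², β/d³)`, conditions (A1), (A2), the height
  formula `h_p(P) = 2 log_p(σ(P)/d(P))`), §5 (displayed evaluation
  `log_p(σ_p(mQ)/d(mQ)) = log_p((-α/β)(1 + Σ c_{k+1} t^k))`, "`α(mQ)/β(mQ)` is a unit … `1 + Σ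
  c_{k+1}t(mQ)^k` is a unit, again because `t(mQ) = -d(mQ)α(mQ)/β(mQ)` is divisible by `p`";
  Lemma 8: `log_p u mod p^N` depends only on `u mod p^N`).
* [MazurSteinTate2006] B. Mazur, W. Stein, J. Tate, Doc. Math. Extra Vol. Coates (2006), §1
  eq. (1.1), Thm. 1.3 (`σ = t + ⋯ ∈ tℤ_p⟦t⟧`, odd).
* [SteinWuthrich2013] W. Stein, C. Wuthrich, Math. Comp. 82 (2013), §4.1 eq. (4.1).
* [SilvermanAEC2009] J. H. Silverman, *AEC* 2nd ed., VII.2.2 (`3v(x) = 2v(y)` on `E₁`).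

## Design

Hypotheses are exactly what the VALUE `canonicalPAdicHeight p P` needs: `[W.IsIntegral ℤ]`, `p ≠ 2`,
`‖x‖_p > 1` — no minimality, no good/ordinary reduction, no admissibility (those enter only through
`IsCanonical`). The error is stated as `‖x/y‖_p` resp. `‖x‖_p⁻¹` (no real exponents). `x.num` is
Mathlib's `Rat.num` (lowest terms); for `x = a/e²` in lowest terms with `a = α²` one rewrites
`log_p(num x) = 2 log_p α` by `padicLog_sq`.
-/

noncomputable section

open scoped Classical
open PowerSeries Literature.NumberTheory.EllipticCurves

namespace WeierstrassCurve

/-! ### `σ_p(t) = t·(1 + O(t))`, and `= t·(1 + O(t²))` when `a₁ = a₃ = 0` -/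

section Sigma

variable {p : ℕ} [Fact p.Prime]

/-- `‖σ_p(t) - t‖ ≤ ‖t‖²` for `‖t‖ < 1` (`σ_p ∈ t + t²ℤ_p⟦t⟧`, Mazur–Tate pair or junk value `t`).
[Mazur–Stein–Tate 2006, Thm. 1.3] [folklore] -/
private theorem norm_padicSigmaEval_sub_le_sq (W : WeierstrassCurve ℚ) {t : ℚ_[p]} (ht : ‖t‖ < 1) :
    ‖W.padicSigmaEval p t - t‖ ≤ ‖t‖ ^ 2 := by
  have hsum := (W.baseChange ℚ_[p]).summable_padicSigma ht
  unfold padicSigmaEval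
  rw [hsum.tsum_eq_zero_add, (summable_nat_add_iff 1 |>.mpr hsum).tsum_eq_zero_add]
  simp only [coeff_zero_padicSigma, zero_mul, zero_add, coeff_one_padicSigma, one_mul, pow_one,
    add_sub_cancel_left]
  have hbound : ∀ n : ℕ, ‖coeff (n + 1 + 1) (W.baseChange ℚ_[p]).padicSigma * t ^ (n + 1 + 1)‖ ≤
      ‖t‖ ^ 2 := fun n => by
    rw [norm_mul, norm_pow]
    calc ‖coeff (n + 1 + 1) (W.baseChange ℚ_[p]).padicSigma‖ * ‖t‖ ^ (n + 1 + 1)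
        ≤ 1 * ‖t‖ ^ (n + 1 + 1) := by
          gcongr; exact norm_coeff_padicSigma_le _ _
      _ ≤ ‖t‖ ^ 2 := by
          rw [one_mul]
          exact pow_le_pow_of_le_one (norm_nonneg t) ht.le (by omega)
  exact IsUltrametricDist.norm_tsum_le_of_forall_le hbound

/-- For `a₁ = a₃ = 0` the canonical sigma function is an odd series, so its even coefficients
vanish (Mazur–Tate pair: `IsFormallyOdd.coeff_eq_zero_of_even`; junk value `t`: trivially).
[Mazur–Stein–Tate 2006, Thm. 1.3 (`σ = t + (a₁/2)t² + ⋯`)] [folklore] -/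
private theorem coeff_padicSigma_eq_zero_of_even (V : WeierstrassCurve ℚ_[p]) [V.IsCharNeTwoNF]
    {n : ℕ} (hn : Even n) : coeff n V.padicSigma = 0 := by
  by_cases h : ∃ σ : ℚ_[p]⟦X⟧, ∃ c, V.IsMazurTateSigmaPair σ c
  · exact IsFormallyOdd.coeff_eq_zero_of_even V (V.isMazurTateSigmaPair_padicSigma h).odd hn
  · have h' : ¬ ∃ σc : ℚ_[p]⟦X⟧ × ℚ_[p], V.IsMazurTateSigmaPair σc.1 σc.2 := by
      rintro ⟨σc, hσc⟩; exact h ⟨σc.1, σc.2, hσc⟩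
    have hX : V.padicSigma = X := by
      unfold padicSigma mazurTatePair
      rw [dif_neg h']
    rw [hX, coeff_X, if_neg]
    rintro rfl
    exact Nat.not_even_one hn

/-- `‖σ_p(t) - t‖ ≤ ‖t‖³` for `‖t‖ < 1` when `a₁ = a₃ = 0` (no `t²` term). [folklore] -/
private theorem norm_padicSigmaEval_sub_le_cube (W : WeierstrassCurve ℚ) [W.IsCharNeTwoNF]
    {t : ℚ_[p]} (ht : ‖t‖ < 1) : ‖W.padicSigmaEval p t - t‖ ≤ ‖t‖ ^ 3 := by
  haveI : (W.baseChange ℚ_[p]).IsCharNeTwoNF := ⟨by simp, by simp⟩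
  have hsum := (W.baseChange ℚ_[p]).summable_padicSigma ht
  unfold padicSigmaEval
  rw [hsum.tsum_eq_zero_add, (summable_nat_add_iff 1 |>.mpr hsum).tsum_eq_zero_add]
  simp only [coeff_zero_padicSigma, zero_mul, zero_add, coeff_one_padicSigma, one_mul, pow_one,
    add_sub_cancel_left]
  have h2 : coeff 2 (W.baseChange ℚ_[p]).padicSigma = 0 :=
    coeff_padicSigma_eq_zero_of_even _ (by decide)
  have hbound : ∀ n : ℕ, ‖coeff (n + 1 + 1) (W.baseChange ℚ_[p]).padicSigma * t ^ (n + 1 + 1)‖ ≤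
      ‖t‖ ^ 3 := fun n => by
    rcases n with _ | n
    · rw [show 0 + 1 + 1 = 2 from rfl, h2, zero_mul, norm_zero]; positivity
    rw [norm_mul, norm_pow]
    calc ‖coeff (n + 1 + 1 + 1) (W.baseChange ℚ_[p]).padicSigma‖ * ‖t‖ ^ (n + 1 + 1 + 1)
        ≤ 1 * ‖t‖ ^ (n + 1 + 1 + 1) := by
          gcongr; exact norm_coeff_padicSigma_le _ _
      _ ≤ ‖t‖ ^ 3 := by
          rw [one_mul]
          exact pow_le_pow_of_le_one (norm_nonneg t) ht.le (by omega)
  exact IsUltrametricDist.norm_tsum_le_of_forall_le hbound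

end Sigma

/-! ### The Iwasawa logarithm near `1` (odd `p`) -/

section Log

variable {p : ℕ} [Fact p.Prime]

/-- `‖2‖_p = 1` for odd `p`. [folklore] -/
private theorem norm_two_eq_one (hp : p ≠ 2) : ‖(2 : ℚ_[p])‖ = 1 := by
  rw [show (2 : ℚ_[p]) = ((2 : ℕ) : ℚ_[p]) by norm_cast, Padic.norm_natCast_eq_one_iff]
  exact ((Nat.coprime_primes Nat.prime_two (Fact.out : p.Prime)).mpr (Ne.symm hp)).symm

/-- `‖log_p y‖ = ‖1 - y‖` for `‖1 - y‖ < 1`, `p` odd (the logarithm is an isometry on `1 + pℤ_p`).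
[Iwasawa 1972, §4.4] [folklore] -/
private theorem norm_padicLog_eq_of_norm_one_sub_lt (hp : p ≠ 2) {y : ℚ_[p]} (hy : ‖1 - y‖ < 1) :
    ‖padicLog p y‖ = ‖1 - y‖ := by
  rw [padicLog_eq_padicLogSeries hy]
  exact norm_padicLogSeries_eq (by rwa [norm_two_eq_one hp])

/-- `log_p x⁻¹ = -log_p x`. [Iwasawa 1972, §4.4] [folklore] -/
private theorem padicLog_inv' {x : ℚ_[p]} (hx : x ≠ 0) : padicLog p x⁻¹ = -padicLog p x := by
  have h := padicLog_mul_holds p hx (inv_ne_zero hx)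
  rw [mul_inv_cancel₀ hx, padicLog_one] at h
  linear_combination -h

end Log

/-! ### The estimate -/

section Main

open scoped NNReal

variable (W : WeierstrassCurve ℚ) [W.IsIntegral ℤ] (p : ℕ) [Fact p.Prime]

variable {W p} in
/-- AEC VII.2.2 in `p`-adic norms: for `P = (x, y) ∈ E(ℚ)` with `‖x‖_p > 1` (integral equation),
`y ≠ 0`, `‖z(P)‖_p < 1` and `‖z(P)‖_p² · ‖x‖_p = 1` (`3 v(x) = 2 v(y)`). [Silverman AEC VII.2.2]
[folklore] -/
private theorem cast_y_ne_zero_and_norm_param {x y : ℚ} (h : W.toAffine.Nonsingular x y)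
    (hx : 1 < ‖(x : ℚ_[p])‖) :
    (y : ℚ_[p]) ≠ 0 ∧ ‖-(x : ℚ_[p]) / y‖ < 1 ∧ ‖-(x : ℚ_[p]) / y‖ ^ 2 * ‖(x : ℚ_[p])‖ = 1 := by
  have hv := integers_localIntegers p
  have h1 : ((W.localModel p).baseChange ℚ).toAffine.Equation x y := h.1
  have hx' : 1 < ratAdicValuation p x := by
    rw [ratAdicValuation_apply, ← NNReal.coe_lt_coe, NNReal.coe_one, coe_nnnorm]; exact hx
  obtain ⟨hy, hz, -, -, hzx⟩ := Literature.NumberTheory.EllipticCurves.v_zw_of_one_lt hv h1 hx'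
  rw [ratAdicValuation_apply, ← NNReal.coe_lt_coe, NNReal.coe_one, coe_nnnorm, Rat.cast_div,
    Rat.cast_neg] at hz
  rw [ratAdicValuation_apply, ratAdicValuation_apply] at hzx
  have hzx' := congrArg (fun r : ℝ≥0 => (r : ℝ)) hzx
  simp only [NNReal.coe_mul, NNReal.coe_pow, coe_nnnorm, NNReal.coe_one, Rat.cast_div,
    Rat.cast_neg] at hzx'
  exact ⟨by exact_mod_cast hy, hz, hzx'⟩

variable {W p} in
/-- The engine: with `t = z(P)`, `X = x(P)`, if `‖σ_p(t) - t‖ ≤ ε‖t‖`, `‖a₁t + a₃t/X‖ ≤ ε` and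
`‖t‖² ≤ ε < 1` then `‖ĥ_p(P) - log_p(num x)‖ ≤ ε`. Proof: `x·den = num`, the curve equation
gives `1 - a₁t - a₃t/x = x (1 + u) t²` with `u = a₂/x + a₄/x² + a₆/x³`, `‖u‖ ≤ ‖x‖⁻¹ = ‖t‖²`, and
`σ_p(t) = t·S` with `‖S - 1‖ ≤ ε`; so `ĥ_p(P) - log_p(num x) = log_p(1+u) - log_p(1 - a₁t - a₃t/x)
- 2 log_p S`, each of norm `≤ ε` by the isometry of `log_p` on `1 + pℤ_p`. [Harvey 2008, §5;
Mazur–Stein–Tate 2006, §1 eq. (1.1)] [folklore] -/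
private theorem norm_canonicalPAdicHeight_sub_le_aux (hp : p ≠ 2) {x y : ℚ}
    (h : W.toAffine.Nonsingular x y) (hx : 1 < ‖(x : ℚ_[p])‖) {ε : ℝ} (hε1 : ε < 1)
    (hε : ‖-(x : ℚ_[p]) / y‖ ^ 2 ≤ ε)
    (hS : ‖W.padicSigmaEval p (-(x : ℚ_[p]) / y) - (-(x : ℚ_[p]) / y)‖ ≤ ε * ‖-(x : ℚ_[p]) / y‖)
    (hA : ‖(W.a₁ : ℚ_[p]) * (-(x : ℚ_[p]) / y) + (W.a₃ : ℚ_[p]) * (-(x : ℚ_[p]) / y) / x‖ ≤ ε) :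
    ‖W.canonicalPAdicHeight p (.some x y h) - padicLog p (x.num : ℚ_[p])‖ ≤ ε := by
  obtain ⟨hY, ht1, htx⟩ := cast_y_ne_zero_and_norm_param h hx
  set X : ℚ_[p] := (x : ℚ_[p]) with hXdef
  set Y : ℚ_[p] := (y : ℚ_[p]) with hYdef
  set t : ℚ_[p] := -X / Y with htdef
  set L := padicLog p with hLdef
  have hX0 : X ≠ 0 := by
    rintro h0; rw [h0, norm_zero] at hx; exact not_lt.mpr zero_le_one hx
  have hx0 : x ≠ 0 := by rintro rfl; exact hX0 (by rw [hXdef, Rat.cast_zero])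
  have ht0 : t ≠ 0 := div_ne_zero (neg_ne_zero.mpr hX0) hY
  have htpos : 0 < ‖t‖ := norm_pos_iff.mpr ht0
  have hXinv : ‖X‖⁻¹ = ‖t‖ ^ 2 := (eq_inv_of_mul_eq_one_left htx).symm
  have hX1 : 1 ≤ ‖X‖ := hx.le
  -- integrality of the coefficients
  have ha₂ : ‖(W.a₂ : ℚ_[p])‖ ≤ 1 := (mem_localIntegers_iff p _).mp (W.a₂_mem_localIntegers p)
  have ha₄ : ‖(W.a₄ : ℚ_[p])‖ ≤ 1 := (mem_localIntegers_iff p _).mp (W.a₄_mem_localIntegers p)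
  have ha₆ : ‖(W.a₆ : ℚ_[p])‖ ≤ 1 := (mem_localIntegers_iff p _).mp (W.a₆_mem_localIntegers p)
  -- the curve equation in `ℚ_p`
  have heq : Y ^ 2 + (W.a₁ : ℚ_[p]) * X * Y + (W.a₃ : ℚ_[p]) * Y =
      X ^ 3 + (W.a₂ : ℚ_[p]) * X ^ 2 + (W.a₄ : ℚ_[p]) * X + (W.a₆ : ℚ_[p]) := by
    have e := (WeierstrassCurve.Affine.equation_iff x y).mp h.1
    have e' := congrArg (fun q : ℚ => (q : ℚ_[p])) e
    push_cast at e'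
    exact e'
  -- `u` and its norm
  set u : ℚ_[p] := (W.a₂ : ℚ_[p]) / X + (W.a₄ : ℚ_[p]) / X ^ 2 + (W.a₆ : ℚ_[p]) / X ^ 3 with hudef
  have hterm : ∀ (a : ℚ_[p]) (k : ℕ), ‖a‖ ≤ 1 → 1 ≤ k → ‖a / X ^ k‖ ≤ ‖X‖⁻¹ := by
    intro a k ha hk
    rw [norm_div, norm_pow]
    calc ‖a‖ / ‖X‖ ^ k ≤ 1 / ‖X‖ ^ k := by gcongr
      _ ≤ 1 / ‖X‖ ^ 1 :=
          div_le_div_of_nonneg_left zero_le_one (pow_pos (one_pos.trans_le hX1) 1)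
            (pow_le_pow_right₀ hX1 hk)
      _ = ‖X‖⁻¹ := by rw [pow_one, one_div]
  have hu : ‖u‖ ≤ ‖X‖⁻¹ := by
    refine (IsUltrametricDist.norm_add_le_max _ _).trans (max_le ?_ (hterm _ 3 ha₆ (by omega)))
    refine (IsUltrametricDist.norm_add_le_max _ _).trans (max_le ?_ (hterm _ 2 ha₄ (by omega)))
    simpa using hterm _ 1 ha₂ le_rfl
  have hu' : ‖u‖ ≤ ε := hu.trans (hXinv ▸ hε)
  have hu1 : ‖u‖ < 1 := hu'.trans_lt hε1
  have h1u : ‖1 - (1 + u)‖ < 1 := by rwa [sub_add_cancel_left, norm_neg]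
  have h1u0 : 1 + u ≠ 0 := by
    intro h0; rw [h0, sub_zero, norm_one] at h1u; exact lt_irrefl _ h1u
  -- `B = 1 - a₁t - a₃t/x = x (1+u) t²`
  set B : ℚ_[p] := 1 - (W.a₁ : ℚ_[p]) * t - (W.a₃ : ℚ_[p]) * t / X with hBdef
  have hB : B = X * (1 + u) * t ^ 2 := by
    rw [hBdef, hudef, htdef]
    field_simp
    linear_combination heq
  have h1B : ‖1 - B‖ ≤ ε := by
    have : 1 - B = (W.a₁ : ℚ_[p]) * t + (W.a₃ : ℚ_[p]) * t / X := by rw [hBdef]; ring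
    rw [this]; exact hA
  have h1B1 : ‖1 - B‖ < 1 := h1B.trans_lt hε1
  have hB0 : B ≠ 0 := by
    rw [hB]; exact mul_ne_zero (mul_ne_zero hX0 h1u0) (pow_ne_zero 2 ht0)
  -- `σ_p(t) = t · S`, `‖S - 1‖ ≤ ε`
  set σ : ℚ_[p] := W.padicSigmaEval p t with hσdef
  have hσ0 : σ ≠ 0 := W.padicSigmaEval_ne_zero p ht0 ht1
  set S : ℚ_[p] := σ / t with hSdef
  have hσS : σ = t * S := by rw [hSdef, mul_div_cancel₀ _ ht0]
  have hS0 : S ≠ 0 := div_ne_zero hσ0 ht0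
  have h1S : ‖1 - S‖ ≤ ε := by
    have : 1 - S = -((σ - t) / t) := by rw [hSdef]; field_simp; ring
    rw [this, norm_neg, norm_div, div_le_iff₀ htpos]
    exact hS
  have h1S1 : ‖1 - S‖ < 1 := h1S.trans_lt hε1
  -- numerator and denominator
  have hnum0 : (x.num : ℚ_[p]) ≠ 0 := by exact_mod_cast Rat.num_ne_zero.mpr hx0
  have hden0 : (x.den : ℚ_[p]) ≠ 0 := by exact_mod_cast x.den_nz
  have hXnd : X = (x.num : ℚ_[p]) / (x.den : ℚ_[p]) := by
    rw [hXdef]; exact_mod_cast (Rat.num_div_den x).symm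
  have hden : ((x.den : ℚ) : ℚ_[p]) = (x.num : ℚ_[p]) * X⁻¹ := by
    rw [hXnd, inv_div, mul_div_cancel₀ _ hnum0]; norm_cast
  -- logarithms
  have hLden : L ((x.den : ℚ) : ℚ_[p]) = L (x.num : ℚ_[p]) - L X := by
    rw [hden, hLdef, padicLog_mul_holds p hnum0 (inv_ne_zero hX0), padicLog_inv' hX0]; ring
  have hLσ : L σ = L t + L S := by rw [hσS, hLdef, padicLog_mul_holds p ht0 hS0]
  have hLB : L B = L X + L (1 + u) + 2 * L t := by
    rw [hB, hLdef, padicLog_mul_holds p (mul_ne_zero hX0 h1u0) (pow_ne_zero 2 ht0),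
      padicLog_mul_holds p hX0 h1u0, padicLog_sq ht0]
  have hmain : W.canonicalPAdicHeight p (.some x y h) - L (x.num : ℚ_[p]) =
      L (1 + u) + -L B + -(2 * L S) := by
    rw [canonicalPAdicHeight_some, padicSigmaAt, padicParam_some, ← hLdef, ← hσdef, hLden, hLσ]
    linear_combination hLB
  -- norms of the three logarithms
  have n1 : ‖L (1 + u)‖ ≤ ε := by
    rw [hLdef, norm_padicLog_eq_of_norm_one_sub_lt hp h1u, sub_add_cancel_left, norm_neg]; exact hu'
  have n2 : ‖-L B‖ ≤ ε := by
    rw [norm_neg, hLdef, norm_padicLog_eq_of_norm_one_sub_lt hp h1B1]; exact h1B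
  have n3 : ‖-(2 * L S)‖ ≤ ε := by
    rw [norm_neg, norm_mul]
    calc ‖(2 : ℚ_[p])‖ * ‖L S‖ ≤ 1 * ‖L S‖ := by
          gcongr; simpa using norm_natCast_le_one (p := p) 2
      _ ≤ ε := by
          rw [one_mul, hLdef, norm_padicLog_eq_of_norm_one_sub_lt hp h1S1]; exact h1S
  rw [hmain]
  refine (IsUltrametricDist.norm_add_le_max _ _).trans (max_le ?_ n3)
  exact (IsUltrametricDist.norm_add_le_max _ _).trans (max_le n1 n2)

variable {W p} in
/-- **`‖z(P)‖_p² = ‖x(P)‖_p⁻¹` on `E₁(ℚ_p)`** (`3 v(x) = 2 v(y)`): for a `ℤ`-integral equation and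
`P = (x, y) ∈ E(ℚ)` with `‖x‖_p > 1`. [Silverman AEC VII.2.2] [cite: SilvermanAEC2009, VII.2.2] -/
theorem norm_div_sq_eq_inv_norm_of_one_lt_norm {x y : ℚ} (h : W.toAffine.Nonsingular x y)
    (hx : 1 < ‖(x : ℚ_[p])‖) : ‖(x : ℚ_[p]) / y‖ ^ 2 = ‖(x : ℚ_[p])‖⁻¹ := by
  obtain ⟨-, -, htx⟩ := cast_y_ne_zero_and_norm_param h hx
  rw [neg_div, norm_neg] at htx
  exact eq_inv_of_mul_eq_one_left htx

variable {W p} in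
/-- **The canonical `p`-adic height is `log_p` of the numerator of `x`, to first order.** For a
`ℤ`-integral Weierstrass equation `W/ℚ`, an odd prime `p` and a rational point `P = (x, y)` with
`‖x‖_p > 1` (i.e. `P ∈ E₁(ℚ_p)`), writing `x = α/d²` in lowest terms (`α = num x`),

  `‖ĥ_p(P) - log_p α‖_p ≤ ‖z(P)‖_p = ‖x/y‖_p` (`= ‖x‖_p^{-1/2}`),

where `ĥ_p(P) = log_p(den x) - 2 log_p σ_p(z(P))` is the sigma formula
(`WeierstrassCurve.canonicalPAdicHeight`, Stein–Wuthrich 2013 (4.1) = `-2p ×` MST 2006 (1.1)).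
This is the first-order truncation of Harvey's evaluation of the height formula:
`log_p(σ_p(P)/d(P)) = log_p(-(α/β)·(1 + Σ_{k≥1} c_{k+1} z(P)^k))` with `α/β` and the bracket
`p`-adic units (Harvey 2008, §5), together with `β² = α³(1 + O(d²/α))` from the Weierstrass
equation and the isometry `‖log_p(1+ε)‖ = ‖ε‖` (ibid., Lemma 8). No minimality, reduction type or
admissibility hypothesis is needed for the VALUE `ĥ_p(P)`; for the canonical DATUM see
`PAdicHeightData.IsCanonical.norm_pairing_self_sub_padicLog_num_le`.
[cite: Harvey2008, §5 (evaluation of log_p(σ_p(mQ)/d(mQ)); Lemma 8)] -/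
theorem norm_canonicalPAdicHeight_sub_padicLog_num_le (hp : p ≠ 2) {x y : ℚ}
    (h : W.toAffine.Nonsingular x y) (hx : 1 < ‖(x : ℚ_[p])‖) :
    ‖W.canonicalPAdicHeight p (.some x y h) - padicLog p (x.num : ℚ_[p])‖ ≤ ‖(x : ℚ_[p]) / y‖ := by
  obtain ⟨hY, ht1, htx⟩ := cast_y_ne_zero_and_norm_param h hx
  have hX1 : 1 ≤ ‖(x : ℚ_[p])‖ := hx.le
  have hXpos : 0 < ‖(x : ℚ_[p])‖ := one_pos.trans_le hX1
  have ha₁ : ‖(W.a₁ : ℚ_[p])‖ ≤ 1 := (mem_localIntegers_iff p _).mp (W.a₁_mem_localIntegers p)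
  have ha₃ : ‖(W.a₃ : ℚ_[p])‖ ≤ 1 := (mem_localIntegers_iff p _).mp (W.a₃_mem_localIntegers p)
  have key := norm_canonicalPAdicHeight_sub_le_aux hp h hx (ε := ‖-(x : ℚ_[p]) / y‖) ht1
    (pow_le_of_le_one (norm_nonneg _) ht1.le two_ne_zero)
    (by rw [← sq]; exact norm_padicSigmaEval_sub_le_sq W ht1) (by
      refine (IsUltrametricDist.norm_add_le_max _ _).trans (max_le ?_ ?_)
      · rw [norm_mul]
        exact mul_le_of_le_one_left (norm_nonneg _) ha₁
      · rw [norm_div, norm_mul, div_le_iff₀ hXpos]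
        calc ‖(W.a₃ : ℚ_[p])‖ * ‖-(x : ℚ_[p]) / y‖ ≤ 1 * ‖-(x : ℚ_[p]) / y‖ := by gcongr
          _ ≤ ‖-(x : ℚ_[p]) / y‖ * ‖(x : ℚ_[p])‖ := by
              rw [one_mul]; exact le_mul_of_one_le_right (norm_nonneg _) hX1)
  rwa [neg_div, norm_neg] at key

variable {W p} in
/-- **Second-order form for `a₁ = a₃ = 0`** (`y² = x³ + a₂x² + a₄x + a₆`, e.g. short or `2`-isogeny
normal form, `ℤ`-integral; `p` odd; `‖x‖_p > 1`): then `σ_p` is odd (`σ_p = z + O(z³)`, Mazur–Tate)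
and the linear term `a₁z + a₃z/x` vanishes to third order, so

  `‖ĥ_p(P) - log_p(num x)‖_p ≤ ‖x‖_p⁻¹ = ‖z(P)‖_p²`.

[Harvey 2008, §5 and §4 (oddness `σ_p(i(t)) = -σ_p(t)`); Mazur–Stein–Tate 2006, Thm. 1.3]
[cite: Harvey2008, §5 (evaluation of log_p(σ_p(mQ)/d(mQ)); Lemma 8)] -/
theorem norm_canonicalPAdicHeight_sub_padicLog_num_le_inv [W.IsCharNeTwoNF] (hp : p ≠ 2)
    {x y : ℚ} (h : W.toAffine.Nonsingular x y) (hx : 1 < ‖(x : ℚ_[p])‖) :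
    ‖W.canonicalPAdicHeight p (.some x y h) - padicLog p (x.num : ℚ_[p])‖ ≤ ‖(x : ℚ_[p])‖⁻¹ := by
  obtain ⟨hY, ht1, htx⟩ := cast_y_ne_zero_and_norm_param h hx
  have hX1 : 1 ≤ ‖(x : ℚ_[p])‖ := hx.le
  have hXpos : 0 < ‖(x : ℚ_[p])‖ := one_pos.trans_le hX1
  have hXinv : ‖(x : ℚ_[p])‖⁻¹ = ‖-(x : ℚ_[p]) / y‖ ^ 2 := (eq_inv_of_mul_eq_one_left htx).symm
  have ha₃ : ‖(W.a₃ : ℚ_[p])‖ ≤ 1 := (mem_localIntegers_iff p _).mp (W.a₃_mem_localIntegers p)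
  have ht2 : ‖-(x : ℚ_[p]) / y‖ ^ 2 < 1 := pow_lt_one₀ (norm_nonneg _) ht1 two_ne_zero
  rw [hXinv]
  refine norm_canonicalPAdicHeight_sub_le_aux hp h hx ht2 le_rfl ?_ ?_
  · rw [show ‖-(x : ℚ_[p]) / y‖ ^ 2 * ‖-(x : ℚ_[p]) / y‖ = ‖-(x : ℚ_[p]) / y‖ ^ 3 by ring]
    exact norm_padicSigmaEval_sub_le_cube W ht1
  · rw [W.a₁_of_isCharNeTwoNF, Rat.cast_zero, zero_mul, zero_add, norm_div, norm_mul,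
      div_le_iff₀ hXpos, ← hXinv]
    calc ‖(W.a₃ : ℚ_[p])‖ * ‖-(x : ℚ_[p]) / y‖ ≤ 1 * 1 :=
          mul_le_mul ha₃ ht1.le (norm_nonneg _) zero_le_one
      _ = ‖(x : ℚ_[p])‖⁻¹ * ‖(x : ℚ_[p])‖ := by rw [one_mul, inv_mul_cancel₀ hXpos.ne']

/-- **For THE canonical datum**: if `D.IsCanonical` then for every admissible `P = (x, y)`
(`IsAdmissible`: non-torsion, `‖x‖_p > 1`, `z(P)` in the sigma disc, non-singular reduction
everywhere) `‖⟨P, P⟩_D - log_p(num x)‖_p ≤ ‖x/y‖_p` (`ℤ`-integral equation, `p` odd).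
[Mazur–Stein–Tate 2006, §1 eq. (1.1); Harvey 2008, §5] [cite: Harvey2008, §5 (evaluation of log_p(σ_p(mQ)/d(mQ)); Lemma 8)] -/
theorem PAdicHeightData.IsCanonical.norm_pairing_self_sub_padicLog_num_le
    {D : PAdicHeightData W p} (hD : D.IsCanonical) (hp : p ≠ 2) {x y : ℚ}
    {h : W.toAffine.Nonsingular x y} (hadm : W.IsAdmissible p (.some x y h)) :
    ‖D.pairing (.some x y h) (.some x y h) - padicLog p (x.num : ℚ_[p])‖ ≤ ‖(x : ℚ_[p]) / y‖ := by
  rw [hD _ hadm]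
  exact norm_canonicalPAdicHeight_sub_padicLog_num_le hp h hadm.2.1

/-- **For THE canonical datum, `a₁ = a₃ = 0`**: `‖⟨P, P⟩_D - log_p(num x)‖_p ≤ ‖x‖_p⁻¹` for every
admissible `P = (x, y)` (`ℤ`-integral equation, `p` odd). [Mazur–Stein–Tate 2006, §1 eq. (1.1);
Harvey 2008, §5] [cite: Harvey2008, §5 (evaluation of log_p(σ_p(mQ)/d(mQ)); Lemma 8)] -/
theorem PAdicHeightData.IsCanonical.norm_pairing_self_sub_padicLog_num_le_inv [W.IsCharNeTwoNF]
    {D : PAdicHeightData W p} (hD : D.IsCanonical) (hp : p ≠ 2) {x y : ℚ}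
    {h : W.toAffine.Nonsingular x y} (hadm : W.IsAdmissible p (.some x y h)) :
    ‖D.pairing (.some x y h) (.some x y h) - padicLog p (x.num : ℚ_[p])‖ ≤ ‖(x : ℚ_[p])‖⁻¹ := by
  rw [hD _ hadm]
  exact norm_canonicalPAdicHeight_sub_padicLog_num_le_inv hp h hadm.2.1

end Main

end WeierstrassCurve

end
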